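import Literature.Probability.Percolation.RussoFormula
import Literature.Probability.Percolation.HalfSpaceBGN
import HarnessLib

/-!
# `stub_pivotalContinuous` of line `Sketch` (crux `PercTreeValue.EquilateralAntiFactorisation`,
# stmt-CriticalPhenomena-7800): continuity of the expected pivotal count

Registered stub `stub_pivotalContinuous` of the lead's skeleton for the crux
`Summit.CriticalPhenomena.PercolationContinuityZ3.Theses.PercTreeValue.EquilateralAntiFactorisation`
(line `Sketch`, idea `pivotal-deficit-flow`).

Statement: for a local event `E ⊆ BondConfig V` (determined by a finite set `F` of pairs) the map
`q ↦ E_{P_{projIcc q}}[N_E]`, `N_E(ω) = #(pivotals E ω ∩ E(G))` (Russo's derivative, the expected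
number of edges of `G` pivotal for `E`), is continuous on all of `ℝ` (the parameter is clamped to
`[0,1]` by `Set.projIcc`).

Proof: pivotal pairs lie in `F` (`Russo.mem_of_isPivotal`), so pointwise
`N_E(ω) = Σ_{e ∈ F} 1[e ∈ E(G) ∧ e pivotal for E](ω)` (verbatim the count identity in the proof of
`russo_formula_holds`); hence `E_p[N_E] = Σ_{e ∈ F} P_p(e ∈ E(G) pivotal for E)` for every `p`.
Each summand is continuous in `p : [0,1]`: for `e ∈ E(G)` the event is `{e pivotal}`, determined by
`F.erase e` (`Russo.determinedBy_isPivotal`), so `continuous_bondPercolation_real_of_determinedBy`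
applies; for `e ∉ E(G)` it is empty. Compose with `continuous_projIcc` and sum.
-/

noncomputable section

namespace Summit.CriticalPhenomena.PercolationContinuityZ3.Theorems.EquilateralAntiFactorisation

open MeasureTheory
open Literature.Probability.Percolation

namespace PivotalContinuous

variable {V : Type*}

/-- For `e ∈ E(G)`, the event "`e` is an edge of `G` pivotal for `E`" is the event
"`e` is pivotal for `E`". -/
theorem setOf_edge_pivotal_of_mem (G : SimpleGraph V) (E : Set (BondConfig V)) {e : Sym2 V}
    (he : e ∈ G.edgeSet) :
    {ω : BondConfig V | e ∈ G.edgeSet ∧ IsPivotal E e ω} = {ω | IsPivotal E e ω} := by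
  ext ω; simp [he]

/-- For `e ∉ E(G)`, the event "`e` is an edge of `G` pivotal for `E`" is empty. -/
theorem setOf_edge_pivotal_of_notMem (G : SimpleGraph V) (E : Set (BondConfig V)) {e : Sym2 V}
    (he : e ∉ G.edgeSet) :
    {ω : BondConfig V | e ∈ G.edgeSet ∧ IsPivotal E e ω} = ∅ := by
  ext ω; simp [he]

/-- The event "`e` is an edge of `G` pivotal for `E`" is measurable when `E` is determined by a
finite set of pairs (it is determined by `F.erase e`, or empty). -/
theorem measurableSet_edge_pivotal (G : SimpleGraph V) {E : Set (BondConfig V)}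
    {F : Finset (Sym2 V)} (hF : DeterminedBy E (↑F : Set (Sym2 V))) (e : Sym2 V) :
    MeasurableSet {ω : BondConfig V | e ∈ G.edgeSet ∧ IsPivotal E e ω} := by
  classical
  by_cases he : e ∈ G.edgeSet
  · rw [setOf_edge_pivotal_of_mem G E he]
    exact (Russo.determinedBy_isPivotal hF e).measurableSet_of_finset
  · rw [setOf_edge_pivotal_of_notMem G E he]
    exact MeasurableSet.empty

/-- Russo's (4.1): the number of edges of `G` pivotal for `E` in `ω` is the sum over the
determining set `F` of the indicators of "`e` is an edge of `G` pivotal for `E`"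
(pivotal pairs lie in `F`, `Russo.mem_of_isPivotal`). -/
theorem pivotal_count_eq_sum (G : SimpleGraph V) {E : Set (BondConfig V)}
    {F : Finset (Sym2 V)} (hF : DeterminedBy E (↑F : Set (Sym2 V))) (ω : BondConfig V) :
    ((pivotals E ω ∩ G.edgeSet).encard.toNat : ℝ) =
      ∑ e ∈ F, {ω : BondConfig V | e ∈ G.edgeSet ∧ IsPivotal E e ω}.indicator 1 ω := by
  classical
  -- adapted from the count identity `hcount` in `russo_formula_holds` (RussoFormula.lean)
  have hset : pivotals E ω ∩ G.edgeSet =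
      ↑(F.filter fun e => e ∈ G.edgeSet ∧ IsPivotal E e ω) := by
    ext e
    simp only [Set.mem_inter_iff, mem_pivotals, Finset.coe_filter, Set.mem_setOf_eq]
    constructor
    · rintro ⟨hpiv, heE⟩
      exact ⟨Russo.mem_of_isPivotal hF hpiv, heE, hpiv⟩
    · rintro ⟨-, heE, hpiv⟩
      exact ⟨hpiv, heE⟩
  rw [hset, Set.encard_coe_eq_coe_finsetCard, ENat.toNat_coe, Finset.card_filter]
  push_cast
  refine Finset.sum_congr rfl fun e _ => ?_
  simp only [Set.indicator, Set.mem_setOf_eq, Pi.one_apply]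

/-- `E_p[N_E] = Σ_{e ∈ F} P_p(e ∈ E(G) pivotal for E)` for every `p ∈ [0,1]`. -/
theorem integral_pivotal_count_eq_sum (G : SimpleGraph V) {E : Set (BondConfig V)}
    {F : Finset (Sym2 V)} (hF : DeterminedBy E (↑F : Set (Sym2 V))) (p : unitInterval) :
    ∫ ω, ((pivotals E ω ∩ G.edgeSet).encard.toNat : ℝ) ∂(bondPercolation G p) =
      ∑ e ∈ F, (bondPercolation G p).real {ω : BondConfig V | e ∈ G.edgeSet ∧ IsPivotal E e ω} := by
  simp_rw [pivotal_count_eq_sum G hF]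
  rw [integral_finsetSum]
  · refine Finset.sum_congr rfl fun e _ => ?_
    exact integral_indicator_one (measurableSet_edge_pivotal G hF e)
  · intro e _
    exact (integrable_const (1 : ℝ)).indicator (measurableSet_edge_pivotal G hF e)

/-- Each summand `p ↦ P_p(e ∈ E(G) pivotal for E)` is continuous on `[0,1]`: the event is a
cylinder event determined by `F.erase e` (or empty). -/
theorem continuous_real_edge_pivotal (G : SimpleGraph V) {E : Set (BondConfig V)}
    {F : Finset (Sym2 V)} (hF : DeterminedBy E (↑F : Set (Sym2 V))) (e : Sym2 V) :
    Continuous fun p : unitInterval =>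
      (bondPercolation G p).real {ω : BondConfig V | e ∈ G.edgeSet ∧ IsPivotal E e ω} := by
  classical
  by_cases he : e ∈ G.edgeSet
  · simp_rw [setOf_edge_pivotal_of_mem G E he]
    exact continuous_bondPercolation_real_of_determinedBy G (Russo.determinedBy_isPivotal hF e)
  · simp_rw [setOf_edge_pivotal_of_notMem G E he, measureReal_empty]
    exact continuous_const

end PivotalContinuous

open PivotalContinuous in
/-- **S3 (continuity of the expected pivotal count).** For a local event `E` the map
`q ↦ E_{P_{projIcc q}}[N_E]` (expected number of edges of `G` pivotal for `E`, the derivative in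
Russo's formula) is continuous on `ℝ`: it is a finite sum of cylinder probabilities, each
continuous in the clamped parameter. -/
theorem stub_pivotalContinuous {V : Type*} (G : SimpleGraph V) {E : Set (BondConfig V)}
    (hEl : IsLocalEvent E) :
    Continuous fun q : ℝ => ∫ ω, ((pivotals E ω ∩ G.edgeSet).encard.toNat : ℝ)
      ∂(bondPercolation G (Set.projIcc (0 : ℝ) 1 zero_le_one q)) := by
  obtain ⟨F, hF⟩ := hEl
  simp_rw [integral_pivotal_count_eq_sum G hF]
  exact continuous_finsetSum _ fun e _ =>
    (continuous_real_edge_pivotal G hF e).comp continuous_projIcc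

end Summit.CriticalPhenomena.PercolationContinuityZ3.Theorems.EquilateralAntiFactorisation
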